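import Mathlib
import Summits.KontsevichZagierPeriods.KontsevichZagierPeriods.Theorems.SoloInformedSumStar
import Summits.KontsevichZagierPeriods.KontsevichZagierPeriods.Theorems.SoloInformedTelescopeKit
import Literature.NumberTheory.Transcendental.MZVDualIndex
import HarnessLib
import HarnessLib.Audit

/-!
# SoloInformed — THEOREM XLIII: duality of all multiple zeta classes in `𝒫`

Solo programme `solo-KontsevichZagierPeriods-informed`, session s47 (PROGRAMME XLIII). In the
formal period ring `𝒫 = KZ.FormalPeriodRing` (relations = Kontsevich–Zagier's rules only),
Hoffman's duality holds for EVERY admissible index: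

  `mzvClass (MZV.dual s) = mzvClass s`      (`soloInformed_mzvClass_dual`),

`τ(s)` = the index whose binary word is that of `s` read backwards with `0 ↔ 1` (Literature
`MZV.dual`). It is realised inside `KZ.relations` by exactly TWO rule-(2) moves on Kontsevich's
simplex representation `[Δ_N, ω_s]` (`soloInformed_exists_wordRep`): the coordinate reversal
`t ↦ t ∘ rev` (`KZ.of_sub_of_reindex_mem_relations`) followed by the reflection `t ↦ 1 − t` in
every coordinate (a `ℚ`-polynomial change of variables with Jacobian determinant `(−1)^N`,
`soloInformed_of_sub_of_mem_relations_polyMapCLM`); the reflected reversed simplex is the simplex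
again and `ω_ε(1 − t) = ω_{¬ε}(t)`, so the second representation is Kontsevich's representation of
`τ(s)` (`soloInformed_toFormalPeriod_eq_mzvClass`). The weight-4 instance `Z(2,1,1) = Z(4)` was
PART XVI (`soloInformed_mzvClass_duality4`); here all weights and depths at once.

Corollaries in `𝒫`: the weight-5 duals `Z(2,1,1,1) = Z(5)`, `Z(3,1,1) = Z(4,1)`,
`Z(2,2,1) = Z(3,2)`, `Z(2,1,2) = Z(2,3)`, Hoffman's example `Z(3,1,1,2,1) = Z(3,4,1)` and
Hoffman's whole family `Z(n+2,{1}ᵐ) = Z(m+2,{1}ⁿ)` (Theorem 4.4; `Z(2,{1}ⁿ) = Z(n+2)`)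
(`soloInformed_mzvClass_dual_weight5`, `…_dual_hoffman`, `…_hoffmanFamily`, `…_two_ones`).
Under `evalP` the theorem specialises to the Literature's real duality `multipleZeta_dual`.

References: Hoffman 1992 §3 (Duality conjecture) [Hoffman1992]; Zagier 1994 §9 [Zagier1994];
Kontsevich–Zagier 2001 §1.2 [KontsevichZagier2001].
-/

noncomputable section

open MeasureTheory Set MvPolynomial
open Literature.ModelTheory.ExponentialFields Literature.NumberTheory.Transcendental
open Literature.NumberTheory.Transcendental.KZ

namespace Summit.KontsevichZagierPeriods.KontsevichZagierPeriods.Theorems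

variable {N : ℕ}

/-! ## 1. The reflection `t ↦ 1 − t` in dimension `N` -/

/-- The polynomial components `1 − Xⱼ` of the reflection. -/
def soloInformedReflPolyN (N : ℕ) : Fin N → MvPolynomial (Fin N) ℚ := fun j => 1 - X j

/-- `ρ(x)ⱼ = 1 − xⱼ`. -/
@[simp] theorem soloInformed_polyMap_reflPolyN_apply (x : Fin N → ℝ) (j : Fin N) :
    soloInformedPolyMap (soloInformedReflPolyN N) x j = 1 - x j := by
  simp [soloInformedReflPolyN, soloInformedPolyMap]

/-- `ρ ∘ ρ = id`. -/
theorem soloInformed_polyMap_reflPolyN_involutive (x : Fin N → ℝ) :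
    soloInformedPolyMap (soloInformedReflPolyN N)
      (soloInformedPolyMap (soloInformedReflPolyN N) x) = x := by
  ext j
  rw [soloInformed_polyMap_reflPolyN_apply, soloInformed_polyMap_reflPolyN_apply]
  ring

/-- The symbolic Jacobian matrix of `ρ` is `−1`. -/
theorem soloInformed_jacMat_reflPolyN : soloInformedJacMat (soloInformedReflPolyN N) = -1 := by
  ext j i
  by_cases h : j = i
  · subst h
    simp [soloInformedReflPolyN]
  · simp [soloInformedReflPolyN, h]

/-- `det J_ρ = (−1)^N`. -/
theorem soloInformed_det_reflPolyN (x : Fin N → ℝ) :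
    (soloInformedJacCLM (soloInformedReflPolyN N) x).det = (-1) ^ N := by
  rw [soloInformed_det_jacCLM, soloInformed_jacMat_reflPolyN, Matrix.det_neg, Matrix.det_one,
    mul_one, Fintype.card_fin, map_pow, map_neg, map_one]

/-- `|det J_ρ| = 1`. -/
theorem soloInformed_abs_det_reflPolyN (x : Fin N → ℝ) :
    |(soloInformedJacCLM (soloInformedReflPolyN N) x).det| = 1 := by
  rw [soloInformed_det_reflPolyN, abs_pow, abs_neg, abs_one, one_pow]

/-- `ρ` is injective on every set. -/
theorem soloInformed_injOn_reflPolyN (S : Set (Fin N → ℝ)) :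
    InjOn (soloInformedPolyMap (soloInformedReflPolyN N)) S := by
  intro t _ t' _ h
  ext j
  have := congr_fun h j
  simp only [soloInformed_polyMap_reflPolyN_apply] at this
  linarith

/-! ## 2. The reflected reversed simplex is the simplex -/

/-- `ρ` maps the reversed (increasing) simplex onto Kontsevich's (decreasing) simplex. -/
theorem soloInformed_image_reflPolyN_revSimplex :
    soloInformedPolyMap (soloInformedReflPolyN N) ''
        {w : Fin N → ℝ | (fun i => w (Fin.rev i)) ∈ openOrderedSimplex N} =
      openOrderedSimplex N := by
  refine Subset.antisymm ?_ fun t ht => ?_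
  · rintro _ ⟨w, hw, rfl⟩
    obtain ⟨h0, h1, hanti⟩ := hw
    refine ⟨fun j => ?_, fun j => ?_, fun i j hij => ?_⟩
    · have := h1 (Fin.rev j)
      simp only [Fin.rev_rev] at this
      rw [soloInformed_polyMap_reflPolyN_apply]
      linarith
    · have := h0 (Fin.rev j)
      simp only [Fin.rev_rev] at this
      rw [soloInformed_polyMap_reflPolyN_apply]
      linarith
    · have := hanti (Fin.rev_lt_rev.2 hij)
      simp only [Fin.rev_rev] at this
      rw [soloInformed_polyMap_reflPolyN_apply, soloInformed_polyMap_reflPolyN_apply]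
      linarith
  · refine ⟨soloInformedPolyMap (soloInformedReflPolyN N) t, ?_,
      soloInformed_polyMap_reflPolyN_involutive t⟩
    obtain ⟨h0, h1, hanti⟩ := ht
    refine ⟨fun j => ?_, fun j => ?_, fun i j hij => ?_⟩
    · show 0 < soloInformedPolyMap (soloInformedReflPolyN N) t (Fin.rev j)
      rw [soloInformed_polyMap_reflPolyN_apply]
      linarith [h1 (Fin.rev j)]
    · show soloInformedPolyMap (soloInformedReflPolyN N) t (Fin.rev j) < 1
      rw [soloInformed_polyMap_reflPolyN_apply]
      linarith [h0 (Fin.rev j)]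
    · show soloInformedPolyMap (soloInformedReflPolyN N) t (Fin.rev j) <
        soloInformedPolyMap (soloInformedReflPolyN N) t (Fin.rev i)
      have := hanti (Fin.rev_lt_rev.2 hij)
      rw [soloInformed_polyMap_reflPolyN_apply, soloInformed_polyMap_reflPolyN_apply]
      linarith

/-! ## 3. The integrand: `ω_ε(1 − t) = ω_{¬ε}(t)` and the reversed complemented word -/

/-- **The reflected reversed word-product is the word-product of the dual word**
(`ω_{¬ε}(1 − t) = ω_ε(t)`, Literature `KZ.mzvForm_not_one_sub`, `KZ.getD_reverse_map_not`). -/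
theorem soloInformed_dual_wordProd (ε : List Bool) (hl : ε.length = N) (x : Fin N → ℝ) :
    (∏ k : Fin N, mzvForm (ε.getD k false) (x (Fin.rev k))) =
      ∏ k : Fin N, mzvForm ((ε.reverse.map fun b => !b).getD k false) (1 - x k) := by
  rw [← Equiv.prod_comp Fin.revPerm (fun k : Fin N =>
    mzvForm ((ε.reverse.map fun b => !b).getD k false) (1 - x k))]
  refine Finset.prod_congr rfl fun k _ => ?_
  rw [Fin.revPerm_apply, getD_reverse_map_not hl, Fin.rev_rev, mzvForm_not_one_sub]

/-- **Hoffman's family of duals**: `τ(m+2, {1}ⁿ) = (n+2, {1}ᵐ)`. -/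
theorem soloInformed_dual_hoffmanFamily (m n : ℕ) :
    MZV.dual ((m + 2) :: List.replicate n 1) = (n + 2) :: List.replicate m 1 := by
  rw [MZV.dual, MZV.binaryWord_add_two_cons_replicate_one, List.reverse_append,
    List.reverse_replicate, List.reverse_replicate, List.map_append, List.map_replicate,
    List.map_replicate, Bool.not_true, Bool.not_false,
    ← MZV.binaryWord_add_two_cons_replicate_one,
    MZV.ofBinaryWord_binaryWord (MZV.isAdmissible_add_two_cons_replicate_one n m).1]

/-! ## 4. THEOREM XLIII — duality in `𝒫` -/

/-- **THEOREM XLIII (duality of multiple zeta classes in the formal period ring).** For every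
admissible index `s`, `mzvClass (MZV.dual s) = mzvClass s` in `𝒫`: two rule-(2) moves
(coordinate reversal, then `t ↦ 1 − t`) on Kontsevich's simplex representation.
[Hoffman 1992 §3; Zagier 1994 §9; Kontsevich–Zagier 2001 §1.2] -/
theorem soloInformed_mzvClass_dual {s : List ℕ} (hs : MZV.IsAdmissible s) :
    mzvClass (MZV.dual s) = mzvClass s := by
  obtain ⟨r, hd, hi, hc⟩ := soloInformed_exists_wordRep hs rfl
  obtain ⟨r', hd', hi', hc'⟩ :=
    soloInformed_exists_wordRep (MZV.isAdmissible_dual hs) (MZV.weight_dual hs)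
  have h1 : of r - of (r.reindex Fin.revPerm) ∈ relations :=
    of_sub_of_reindex_mem_relations r Fin.revPerm
  have h2 : of (r.reindex Fin.revPerm) - of r' ∈ relations := by
    refine soloInformed_of_sub_of_mem_relations_polyMapCLM (soloInformedReflPolyN _) _ _
      (soloInformed_injOn_reflPolyN _) ?_ fun x _ => ?_
    · rw [hd', IntegralRep.reindex_domain, hd]
      simp only [Fin.revPerm_apply]
      exact soloInformed_image_reflPolyN_revSimplex.symm
    · show r.integrand (fun i => x (Fin.revPerm i)) = _
      rw [hi, hi', soloInformed_abs_det_reflPolyN, mul_one, MZV.binaryWord_dual hs]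
      simp only [Fin.revPerm_apply, soloInformed_polyMap_reflPolyN_apply]
      exact soloInformed_dual_wordProd _ hs.length_binaryWord x
  have h12 : of r - of r' =
      (of r - of (r.reindex Fin.revPerm)) + (of (r.reindex Fin.revPerm) - of r') := by abel
  rw [← hc, ← hc', toFormalPeriod_eq_iff]
  have h := relations.neg_mem (h12 ▸ relations.add_mem h1 h2 : of r - of r' ∈ relations)
  rwa [neg_sub] at h

/-- **`[Δ, ω_s] − [Δ, ω_{τ(s)}] ∈ KZ.relations`** for Kontsevich's Literature representations
`KZ.mzvRep`, as a statement about generators. -/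
theorem soloInformed_mzvClass_dual' {s : List ℕ} (hs : MZV.IsAdmissible s) :
    mzvClass s = mzvClass (MZV.dual s) :=
  (soloInformed_mzvClass_dual hs).symm

/-! ## 5. Instances -/

/-- **The weight-5 duals in `𝒫`**: `Z(2,1,1,1) = Z(5)`, `Z(3,1,1) = Z(4,1)`, `Z(2,2,1) = Z(3,2)`,
`Z(2,1,2) = Z(2,3)` — every weight-5 multiple zeta class of depth ≥ 3 is one of depth ≤ 2. -/
theorem soloInformed_mzvClass_dual_weight5 :
    mzvClass [2, 1, 1, 1] = mzvClass [5] ∧ mzvClass [3, 1, 1] = mzvClass [4, 1] ∧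
      mzvClass [2, 2, 1] = mzvClass [3, 2] ∧ mzvClass [2, 1, 2] = mzvClass [2, 3] := by
  refine ⟨?_, ?_, ?_, ?_⟩
  · rw [← (by decide : MZV.dual [5] = [2, 1, 1, 1])]
    exact soloInformed_mzvClass_dual (by decide)
  · rw [← (by decide : MZV.dual [4, 1] = [3, 1, 1])]
    exact soloInformed_mzvClass_dual (by decide)
  · rw [← (by decide : MZV.dual [3, 2] = [2, 2, 1])]
    exact soloInformed_mzvClass_dual (by decide)
  · rw [← (by decide : MZV.dual [2, 3] = [2, 1, 2])]
    exact soloInformed_mzvClass_dual (by decide)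

/-- **Hoffman's Theorem 4.4 in `𝒫`**: `Z(n+2, {1}ᵐ) = Z(m+2, {1}ⁿ)` for all `m, n`; in
particular `Z(2, {1}ⁿ) = Z(n+2)` (`m = 0`). [Hoffman 1992, Thm 4.4 p. 286] -/
theorem soloInformed_mzvClass_hoffmanFamily (m n : ℕ) :
    mzvClass ((n + 2) :: List.replicate m 1) = mzvClass ((m + 2) :: List.replicate n 1) := by
  rw [← soloInformed_dual_hoffmanFamily m n]
  exact soloInformed_mzvClass_dual (MZV.isAdmissible_add_two_cons_replicate_one m n)

/-- `Z(2, {1}ⁿ) = Z(n+2)` in `𝒫` for every `n`. -/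
theorem soloInformed_mzvClass_two_ones (n : ℕ) :
    mzvClass (2 :: List.replicate n 1) = mzvClass [n + 2] := by
  simpa using soloInformed_mzvClass_hoffmanFamily n 0

/-- **Hoffman's example in `𝒫`**: `Z(3,1,1,2,1) = Z(3,4,1)` (Hoffman 1992, §3 p. 281). -/
theorem soloInformed_mzvClass_dual_hoffman : mzvClass [3, 1, 1, 2, 1] = mzvClass [3, 4, 1] := by
  rw [← (by decide : MZV.dual [3, 4, 1] = [3, 1, 1, 2, 1])]
  exact soloInformed_mzvClass_dual (by decide)

/-- The weight-3 and weight-4 duals recovered: `Z(2,1) = Z(3)` (Euler; PART XV by other moves) and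
`Z(2,1,1) = Z(4)` (PART XVI); `(3,1)` and `(2,2)` are self-dual. -/
theorem soloInformed_mzvClass_dual_low :
    mzvClass [2, 1] = mzvClass [3] ∧ mzvClass [2, 1, 1] = mzvClass [4] := by
  refine ⟨?_, ?_⟩
  · rw [← (by decide : MZV.dual [3] = [2, 1])]
    exact soloInformed_mzvClass_dual (by decide)
  · rw [← (by decide : MZV.dual [4] = [2, 1, 1])]
    exact soloInformed_mzvClass_dual (by decide)

/-- Self-duality carries no information: `τ(3,1) = (3,1)`, `τ(2,2) = (2,2)`, `τ(3,2,1) = (3,2,1)`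
(kernel computation). -/
theorem soloInformed_dual_selfdual_examples :
    MZV.dual [3, 1] = [3, 1] ∧ MZV.dual [2, 2] = [2, 2] ∧ MZV.dual [3, 2, 1] = [3, 2, 1] := by
  decide

end Summit.KontsevichZagierPeriods.KontsevichZagierPeriods.Theorems
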